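import Summits.HodgeConjecture.HodgeConjecture.Theorems.K2LiuFirstTermResidueChain
import Summits.HodgeConjecture.HodgeConjecture.Theorems.K2LiuEisensteinPairingKernel
import Summits.HodgeConjecture.HodgeConjecture.Theorems.K2LiuUndoublingSeparation
import Summits.HodgeConjecture.HodgeConjecture.Theorems.K2LiuDoublingPairingTensorSeparation
import Summits.HodgeConjecture.HodgeConjecture.Theorems.F0LD2FrameTransportPin
import Summits.HodgeConjecture.HodgeConjecture.Theorems.F0LD1ScalarFrameTransport
import Literature.NumberTheory.Automorphic.Liu2021.CurveThetaNonOrthogonal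
import Literature.NumberTheory.K2Lit.SiegelStandardSections
import Literature.NumberTheory.K2Lit.SiegelEisensteinSeriesDoubled
import Literature.NumberTheory.Automorphic.AdelicGLnGlue
import HarnessLib

/-!
# THE s5 PAYER, ASSEMBLY-MODULO-OPEN-SOCKETS: `‹#41› → ‹#42R› → FirstTermThetaPairing` BY VALUE (#47 `K2LiuFirstTermThetaPairing`)

Track B ∕ hLiu418 = stmt-HodgeConjecture-24832, line `K2_Liu_CurveThetaSigs` (unit U6 `Cruxes/HLiu418/Lines/K2_Liu_CurveThetaSigs_U6_FirstTerm.lean`), tier-0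
`Cruxes/HLiu418/Lines/K2_Liu_CurveThetaNonOrthogonal.lean` stub s5 `stub_firstTermThetaPairing : FirstTermThetaPairing` (rev. k :458–:515); deal LEAD F0P6-plan
(g10) 2026-09-04 03:25:32Z (1) «open `Theorems/K2LiuFirstTermThetaPairing.lean` as the ASSEMBLY-MODULO-OPEN-SOCKETS»; seat `hodgecm-mathlib-K2Liu-p03` (g3: road +
organs; g4: residue chain ★ `K2LiuFirstTermResidueChain` + this head).

THE THEOREM `firstTermThetaPairing_of_seam : ‹#41› → ‹#42R› → ‹FirstTermThetaPairing BY VALUE›`: the two hypotheses are the statements of the OPEN sockets #41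
`sig_K2LiuSiegelEisensteinContinuation` (meromorphic continuation of the doubled Siegel Eisenstein series on `Re s > 0`, pole-cleared form, [Tan1999]) and #42R
`sig_K2LiuEisensteinResidueIsThetaIntegral` (the residue at the top pole `s = ½` is a finite sum of doubled line theta lifts, [KudlaRallis1994; Ichino2004;
GanQiuTakeda2014]) of U6 ED. 8 (5598506cb22c5b57 :228, :376) token for token (`IdeleClassGroup` qualified); the conclusion is tier-0 s5 with the line-local
abbreviations `KD ∕ HD ∕ IsStdFamD ∕ ED ∕ pairingZ ∕ twistD` INLINED to their ★ `K2Lit.SiegelDoubled` bodies and `complexConj_dW₁ L ↦ fun _ => map_one _` — the text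
pre-certified by A-plan2 (g35) (scratch `S5TieByValue` 0e7532dee3b06080: tie to `FirstTermThetaPairing` by the one token `exact h`).  When #41 and #42R are ★ the two
hypotheses discharge BY NAME and tier-0 rev. (k+2) ties `stub_firstTermThetaPairing := firstTermThetaPairing_of_seam sig41 sig42R`.

PROOF (road `K2/K2Liu-p03/g3/ROAD-47-FirstTermThetaPairing.K2Liu-p03-g3.md`, every organ ★): (D0) `n′ = 2` is forced by `e₁ : Fin 2 × Fin 1 ≃ Fin n′`; (D41) #41 at the
curve frame `(N, M, n) = (2, 1, 2)`, `dW ≡ 1`, `χ_D = λ̃⁻¹` (★ `isUnitary_toHeckeCharacter`), s5's standard family ⇒ `P, E⋆`; (D42) #42R at the same frame with the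
doubled enumeration `e₂ := Equiv.prodUnique (Fin (2+2)) (Fin 1)` ⇒ lines `a′ᵢ`, constants `κᵢ`, data `Φ′ᵢ, μWᵢ, fᵢ` and the pointwise residue limit; (D43a)–(D46) ★
`K2LiuFirstTermResidueChain.doublingPairing_residue_ne_zero` with `F s := toQuotFun₂ (E⋆(s) ∘ ι ∘ (ιA × ιA))` — measurable and locally uniformly bounded on `[G]²` by ★
`K2LiuEisensteinPairingKernel` (continuity + compact representatives + #41's growth clause), holomorphic by #41 (i), agreeing with `(∏(s−p))·Zc` on `Re s > s₁` by
#41 (iv) and the `s`-independence of the doubling twist (★ `twist_eq_twist`) — ⇒ the residue kernel `Σ κᵢ Θ̃^□ᵢ ∘ ι ∘ (ιA × ιA)` pairs non-trivially with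
`w ⊗ χ_{½}(ι(a,a))·w′`; finite-sum linearity (★ `exists_doublingPairing_ne_zero_of_finset_sum`, kernels continuous by ★ `continuous_toQuotFun₂_doubledLineThetaLift`)
singles out one line; ★ #45D `doublingPairingTensorSeparation` moves its datum into the pure-tensor span; ★ #44∕45R `undoublingSeparation` with the sign data (c1)
`ι₁ := ι`, `h₁V := ⟨0, sign (ι (dV 1)).re⟩` (★ `re_apply_ne_zero_of_complexConj_eq`), `hV :=` positivity of the diagonal of a positive definite matrix (`hpos`), and
`hιAc ∕ hιAr` from the pin (★ `continuous_of_pin`, ★ `mem_range_toAdelic_of_pin`) yields s5's display (the majorant witness is proof-irrelevant against ★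
`hasThetaMajorants_lineThetaKernelDatum₂`).
[cite: Liu2021, App. B Thm. B.4 (1) (a)⇒(c) p. 98; Prop. B.8 (1); Lemmas B.9–B.12 pp. 101–104; Cor. B.5 (3)] [cite: HarrisKudlaSweet1996, §1 Lem. 1.1, (1.25)–(1.30)]
[cite: Tan1999, §1 Main Theorem p. 166] [cite: KudlaRallis1994, §1, §§5–6] [cite: GanQiuTakeda2014, Thm. 20 (i)] [cite: MoeglinWaldspurger1995, IV.1.9]

No definition, no instance, no named fact, no `sorry`; axioms ⊆ {propext, Classical.choice, Quot.sound}.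

## References
* [Liu2021] Y. Liu, Camb. J. Math. 9 (2021), App. B Thm. B.4 (1), Prop. B.8 (1), Lemmas B.9–B.12 pp. 101–104, Cor. B.5 (3).
* [HarrisKudlaSweet1996] M. Harris, S. Kudla, W. J. Sweet, J. AMS 9 (1996), §1 Lem. 1.1 p. 953, (1.25)–(1.30), Lem. 1.3.
* [Tan1999] V. Tan, *Poles of Siegel Eisenstein series on U(n,n)*, Canad. J. Math. 51 (1999), §1 Main Theorem p. 166, §4 Props. 4.1, 4.4, 4.8.
* [KudlaRallis1994] S. Kudla, S. Rallis, Ann. of Math. 140 (1994), §1, §§5–6.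
* [GanQiuTakeda2014] W. T. Gan, Y. Qiu, S. Takeda, Invent. Math. 198 (2014), Thm. 20 (i).
* [MoeglinWaldspurger1995] C. Moeglin, J.-L. Waldspurger, *Spectral Decomposition and Eisenstein Series*, CUP (1995), IV.1.9.

HONEST LABEL: HC_CM is proved only modulo the 7 printed citations (2 remaining named inputs: hLiu418 = stmt-HodgeConjecture-24832, h413 =
stmt-HodgeConjecture-24833) until rung 0 closes; this file is the s5 payer MODULO the open sockets #41 ∕ #42R and moves no counter by itself.
-/

set_option autoImplicit false

set_option linter.dupNamespace false

noncomputable section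

open NumberField hiding IdeleClassGroup
open NumberField.InfinitePlace MeasureTheory IsDedekindDomain Filter
open scoped Matrix ComplexOrder ENNReal InnerProductSpace ComplexConjugate
open scoped NNReal Topology

namespace Summit.HodgeConjecture.HodgeConjecture.Cruxes.HLiu418.K2LiuFirstTermThetaPairing

open Literature.NumberTheory.Automorphic Literature.NumberTheory.Automorphic.UnitaryGroup
open Literature.NumberTheory.Automorphic.UnitaryGroup.CotangentForms
open Literature.NumberTheory.Automorphic.UnitaryCurveForms
open Literature.NumberTheory.Automorphic.IdeleClassGroup
open Literature.NumberTheory.Automorphic.Liu2021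
open Literature.NumberTheory.Automorphic.Liu2021.Def411WeilCarriers
open Literature.NumberTheory.Automorphic.Liu2021.Def411WeilCarriersDoubling
open Literature.NumberTheory.GaloisRepresentations
open Literature.NumberTheory.GelbartRogawski1991 Literature.NumberTheory.GelbartRogawski1991.UnitaryDualPair
open Literature.NumberTheory.GelbartRogawski1991.GRConstruction
open Literature.NumberTheory.Weil1964
open Literature.RepresentationTheory.Liu2021 Literature.RepresentationTheory.HarrisKudlaSweet1996
open Literature.MeasureTheory.Integral
open Literature.NumberTheory.K2Lit.SiegelDoubled
open Literature.NumberTheory.K2Lit.DoubledLineTheta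
open Summit.HodgeConjecture.HodgeConjecture.Cruxes.HLiu418
open Summit.HodgeConjecture.HodgeConjecture.Cruxes.HLiu418.F0LD2FrameTransportPin (continuous_of_pin mem_range_toAdelic_of_pin)
open Summit.HodgeConjecture.HodgeConjecture.Cruxes.HLiu418.F0LD1ScalarFrameTransport (hasThetaMajorants_lineThetaKernelDatum₂)
open Summit.HodgeConjecture.HodgeConjecture.Cruxes.HLiu418.K2LiuEisensteinPairingKernel
open Summit.HodgeConjecture.HodgeConjecture.Cruxes.HLiu418.K2LiuDoubledThetaPairingContinuous (continuous_toQuotFun₂_doubledLineThetaLift)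
open Summit.HodgeConjecture.HodgeConjecture.Cruxes.HLiu418.K2LiuDoublingUnfoldTwist (continuous_twist)
open Summit.HodgeConjecture.HodgeConjecture.Cruxes.HLiu418.K2LiuDoubledLiftSpanReduction (doublingPairing_const_mul)
open Summit.HodgeConjecture.HodgeConjecture.Cruxes.HLiu418.K2LiuFirstTermResidueChain

/-- `toQuotFun₂` commutes with finite linear combinations of kernels (definitional unfolding of ★ `K2Lit.SiegelDoubled.toQuotFun₂`). [folklore] -/
theorem toQuotFun₂_finset_sum {K : Type} [Field K] [NumberField K] (𝒢 : AdelicGroupData.{0} K) {ι' : Type*} (S : Finset ι')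
    (c : ι' → ℂ) (Φ : ι' → 𝒢.Adelic × 𝒢.Adelic → ℂ) :
    toQuotFun₂ 𝒢 (fun g => ∑ i ∈ S, c i * Φ i g) = fun x => ∑ i ∈ S, c i * toQuotFun₂ 𝒢 (Φ i) x :=
  rfl

set_option maxHeartbeats 400000 in -- MEASURED (default 200000 times out at `whnf`∕`isDefEq`): three by-value statements (#41, #42R, s5) + eight organ instantiations in ONE declaration; A-plan2's one-token tie of the s5 statement alone runs at 800000
/-- **#47 — THE s5 PAYER MODULO THE OPEN SOCKETS #41 ∕ #42R**: `‹sig_K2LiuSiegelEisensteinContinuation› → ‹sig_K2LiuEisensteinResidueIsThetaIntegral› →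
FirstTermThetaPairing` (tier-0 s5 by value).  For the curve frame's θ-type cuspidal `π ∋ w, w′`, an Iwasawa datum `𝒦`, a standard family of Siegel sections
`f_s ∈ I_Δ(s, λ̃⁻¹)` and a continuation `Zc` of the doubling pairing `Z(s) = ⟨⟨E^Δ(ι(·,·); f_s), w ⊗ χ_s(ι(a,a))·w′⟩⟩` to `U ∖ {½}` (`U ∋ ½` open convex
`⊇ {Re s > s₁}`, `s₁ ≥ 1`) with a GENUINE POLE at `½`: granted the meromorphic continuation of `E^Δ` on `Re s > 0` with finitely many poles and moderate growth (#41)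
and the first-term identity `Res_{½} E^Δ(f) = Σ κᵢ Θ̃^□_{a′ᵢ}(fᵢ; Φ′ᵢ, μWᵢ)` (#42R), there are a line `⟨a′⟩`, a pure pair `Φ₁, Φ₂ ∈ 𝒮(𝔸²)`, a finite invariant
open-positive `ν` on `[U(⟨a′⟩)]`, a weight `f′` and an integrable slot-2 weight `W₂` with
`⟨⟨ x ↦ ∫ f′(q) conj θ_{Φ₁,λ}(x₁,q) θ_{Φ₂,λ}(x₂,q) dν(q), w ⊗ W₂ ⟩⟩_{[G]²} ≠ 0`.
[cite: Liu2021, App. B Thm. B.4 (1) (a)⇒(c) p. 98; Prop. B.8 (1); Lemmas B.9–B.12 pp. 101–104] [cite: HarrisKudlaSweet1996, §1 Lem. 1.1, (1.25)–(1.30), Lem. 1.3]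
[cite: Tan1999, §1 Main Theorem p. 166] [cite: KudlaRallis1994, §1, §§5–6] [cite: GanQiuTakeda2014, Thm. 20 (i)] -/
theorem firstTermThetaPairing_of_seam :
    (∀ (L : Type) [Field L] [NumberField L] [IsCMField L] {N M n : ℕ} (e : Fin N × Fin M ≃ Fin n)
      (dV : Fin N → L) (hdV : ∀ i, IsCMField.complexConj L (dV i) = dV i) (_hdV0 : ∀ i, dV i ≠ 0)
      (dW : Fin M → L) (hdW : ∀ i, IsCMField.complexConj L (dW i) = dW i) (_hdW0 : ∀ i, dW i ≠ 0)
      (χ : HeckeCharacter L), χ.IsUnitary →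
      ∀ (𝒦 : IwasawaDatum L e dV hdV dW hdW) (f : ℂ → HA L e dV hdV dW hdW → ℂ),
        IsStandardSectionFamily 𝒦 χ f → (∀ s, Continuous (f s)) →
      ∃ (P : Finset ℂ) (Es : ℂ → HA L e dV hdV dW hdW → ℂ),
        (∀ h : HA L e dV hdV dW hdW, DifferentiableOn ℂ (fun s => Es s h) {s : ℂ | 0 < s.re}) ∧
        (∀ s : ℂ, 0 < s.re → Continuous (Es s)) ∧
        (∀ s : ℂ, 0 < s.re → ∀ (γ : ratH L e dV hdV dW hdW) (h : HA L e dV hdV dW hdW),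
          Es s ((γ : HA L e dV hdV dW hdW) * h) = Es s h) ∧
        (∀ (s : ℂ) (h : HA L e dV hdV dW hdW), (n : ℝ) / 2 < s.re →
          Es s h = (∏ p ∈ P, (s - p)) * eisensteinFamilyDelta L e dV hdV dW hdW f s h) ∧
        (∀ z : ℂ, 0 < z.re → ∃ C A r : ℝ, 0 < r ∧ ∀ s : ℂ, dist s z < r → ∀ h : HA L e dV hdV dW hdW,
          ‖Es s h‖ ≤ C * adelicHeightGL (n + n) L (h : GL (Fin (n + n)) (AdeleRing (𝓞 L) L)) ^ A)) →
    (∀ (L : Type) [Field L] [NumberField L] [IsCMField L] {n : ℕ} (e : Fin 2 × Fin 1 ≃ Fin n)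
      (dV : Fin 2 → L) (hdV : ∀ i, IsCMField.complexConj L (dV i) = dV i) (hdV0 : ∀ i, dV i ≠ 0)
      (dW : Fin 1 → L) (hdW : ∀ i, IsCMField.complexConj L (dW i) = dW i) (hdW0 : ∀ i, dW i ≠ 0)
      (lam : Literature.NumberTheory.Automorphic.IdeleClassGroup L →ₜ* Circle) (hlam : IsConjugateSymplectic L lam),
      HasWeight L lam 1 →
      ∀ (𝒦 : IwasawaDatum L e dV hdV dW hdW) (f : ℂ → HA L e dV hdV dW hdW → ℂ),
        IsStandardSectionFamily 𝒦 (toHeckeCharacter L lam⁻¹) f → (∀ s, Continuous (f s)) →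
      ∀ (P : Finset ℂ) (Es : ℂ → HA L e dV hdV dW hdW → ℂ),
        (∀ h : HA L e dV hdV dW hdW, DifferentiableOn ℂ (fun s => Es s h) {s : ℂ | 0 < s.re}) →
        (∀ (s : ℂ) (h : HA L e dV hdV dW hdW), (n : ℝ) / 2 < s.re →
          Es s h = (∏ p ∈ P, (s - p)) * eisensteinFamilyDelta L e dV hdV dW hdW f s h) →
      ∀ {n'' : ℕ} (e₁ : Fin (n + n) × Fin 1 ≃ Fin n''),
      ∃ (k : ℕ) (a' : Fin k → (↥(maximalRealSubfield L))ˣ) (κ : Fin k → ℂ) (Φ' : Fin k → piSchwartzBruhat (↥(maximalRealSubfield L)) (Fin n''))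
        (hρ : ∀ i, HasThetaMajorants fun
          (p : ↥(UnitaryGroup.adelic (↥(maximalRealSubfield L)) L (IsCMField.complexConj L) (n + n) (Matrix.diagonal (dD L e dV hdV dW hdW))) ×
            ↥(UnitaryGroup.adelic (↥(maximalRealSubfield L)) L (IsCMField.complexConj L) 1 (JW (↥(maximalRealSubfield L)) L (a' i))))
          (Φ : piSchwartzBruhat (↥(maximalRealSubfield L)) (Fin n'')) =>
            pairRep (↥(maximalRealSubfield L)) L (IsCMField.complexConj L) (n + n) 1 e₁ (Matrix.diagonal (dD L e dV hdV dW hdW)) (JW (↥(maximalRealSubfield L)) L (a' i))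
              (chiSplittingLine L e₁ (dD L e dV hdV dW hdW) (dD_conj L e dV hdV dW hdW) (dD_ne_zero L e dV hdV dW hdW hdV0 hdW0)
                (toHeckeCharacter L lam⁻¹) (isUnitary_toHeckeCharacter L lam⁻¹)
                ((isOscillatorChar_toHeckeCharacter_iff lam⁻¹).mpr (K2LiuConjugateSymplecticInv.IsConjugateSymplectic.inv hlam)) (TW (↥(maximalRealSubfield L)) (a' i))
                (isUnit_det_TW (↥(maximalRealSubfield L)) (a' i)) (JW (↥(maximalRealSubfield L)) L (a' i)) (JW_eq (↥(maximalRealSubfield L)) L (a' i)))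
              p Φ)
        (μW : ∀ i, @Measure (↥(UnitaryGroup.adelic (↥(maximalRealSubfield L)) L (IsCMField.complexConj L) 1 (JW (↥(maximalRealSubfield L)) L (a' i))) ⧸
          (UnitaryGroup.toAdelic (↥(maximalRealSubfield L)) L (IsCMField.complexConj L) 1 (JW (↥(maximalRealSubfield L)) L (a' i))).range) (borel _))
        (f : ∀ i, C(↥(UnitaryGroup.adelic (↥(maximalRealSubfield L)) L (IsCMField.complexConj L) 1 (JW (↥(maximalRealSubfield L)) L (a' i))) ⧸
          (UnitaryGroup.toAdelic (↥(maximalRealSubfield L)) L (IsCMField.complexConj L) 1 (JW (↥(maximalRealSubfield L)) L (a' i))).range, ℂ)),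
        (∀ i, @IsFiniteMeasure _ (borel _) (μW i)) ∧
        (∀ i, @SMulInvariantMeasure
          ↥(UnitaryGroup.adelic (↥(maximalRealSubfield L)) L (IsCMField.complexConj L) 1 (JW (↥(maximalRealSubfield L)) L (a' i)))
          (↥(UnitaryGroup.adelic (↥(maximalRealSubfield L)) L (IsCMField.complexConj L) 1 (JW (↥(maximalRealSubfield L)) L (a' i))) ⧸
            (UnitaryGroup.toAdelic (↥(maximalRealSubfield L)) L (IsCMField.complexConj L) 1 (JW (↥(maximalRealSubfield L)) L (a' i))).range)
          _ (borel _) (μW i)) ∧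
        ∀ h : HA L e dV hdV dW hdW,
          Tendsto (fun s : ℂ => (s - 1 / 2) * (Es s h / ∏ p ∈ P, (s - p))) (𝓝[≠] (1 / 2))
            (𝓝 (∑ i, κ i * @doubledLineThetaLift L _ _ _ 2 1 n e dV hdV dW hdW n'' e₁ hdV0 hdW0 lam⁻¹ (K2LiuConjugateSymplecticInv.IsConjugateSymplectic.inv hlam) (a' i) (hρ i)
              (borel _) (μW i) (Φ' i) (f i) h))) →
    ∀ (L : Type) [Field L] [NumberField L] [IsCMField L] (ι : L →+* ℂ) (H : Matrix (Fin 2) (Fin 2) L)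
    (dV : Fin 2 → L) (hdV : ∀ i, IsCMField.complexConj L (dV i) = dV i) (hdV0 : ∀ i, dV i ≠ 0)
    (t : L) (ht : t ≠ 0) (g : GL (Fin 2) L)
    (hg : formCongr ((IsCMField.complexConj L : L ≃ₐ[↥(maximalRealSubfield L)] L) : L →+* L) g (t • H) = Matrix.diagonal dV),
    (∃ T : GL (Fin 2) ℂ, formCongr (starRingEnd ℂ) T ((Matrix.diagonal dV).map ι) = Matrix.diagonal ![(1 : ℂ), -1]) →
    ∀ (hpos : ∀ τ' : L →+* ℂ, InfinitePlace.mk τ' ≠ InfinitePlace.mk ι → ((Matrix.diagonal dV).map τ').PosDef),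
    4 ≤ Module.finrank ℚ L →
    ∀ (μ : Measure (adelicGroupData (↥(maximalRealSubfield L)) L (IsCMField.complexConj L) 2 H).automorphicQuotient)
      [(adelicGroupData (↥(maximalRealSubfield L)) L (IsCMField.complexConj L) 2 H).IsAutomorphicMeasure μ]
      {n' : ℕ} (e₁ : Fin 2 × Fin 1 ≃ Fin n')
      (lam : Literature.NumberTheory.Automorphic.IdeleClassGroup L →ₜ* Circle) (hlam : IsConjugateSymplectic L lam), HasWeight L lam 1 →
    ∀ (a : (↥(maximalRealSubfield L))ˣ) (χ : Chi (↥(maximalRealSubfield L)) L (IsCMField.complexConj L))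
      (W : Type) [AddCommGroup W] [Module ℂ W]
      (σ : Representation ℂ (finAdelic (↥(maximalRealSubfield L)) L (IsCMField.complexConj L) 2 H) W),
      σ.IsIrreducible → σ.IsSmooth →
    ∀ j : σ.IntertwiningMap
        ((rhoVAtLine (↥(maximalRealSubfield L)) L (IsCMField.complexConj L) 2 e₁ (Matrix.diagonal dV)
            (complexConj_imagUnit L) (imagUnit_ne_zero L) (imagUnit_mul_self L) (realDiagonal_isSymm L dV hdV)
            (isUnit_det_realDiagonal L dV hdV hdV0) (realDiagonal_map L dV hdV).symm
            (fun a => isCompatible_chiSplittingLine L e₁ dV hdV hdV0 (toHeckeCharacter L lam)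
              (isUnitary_toHeckeCharacter L lam) ((isOscillatorChar_toHeckeCharacter_iff lam).mpr hlam)
              (TW (↥(maximalRealSubfield L)) a) (isSymm_TW (↥(maximalRealSubfield L)) a)
              (isUnit_det_TW (↥(maximalRealSubfield L)) a) (JW (↥(maximalRealSubfield L)) L a)
              (JW_eq (↥(maximalRealSubfield L)) L a)) a χ).comp
          (finAdelicCongr (↥(maximalRealSubfield L)) L (IsCMField.complexConj L) g ht hg).symm.toMonoidHom),
      Function.Injective j →
    ∀ (ιA : (adelicGroupData (↥(maximalRealSubfield L)) L (IsCMField.complexConj L) 2 H).Adelic →*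
        ↥(UnitaryGroup.adelic (↥(maximalRealSubfield L)) L (IsCMField.complexConj L) 2 (Matrix.diagonal dV))),
      (∀ k, ((ιA k : ↥(UnitaryGroup.adelic (↥(maximalRealSubfield L)) L (IsCMField.complexConj L) 2 (Matrix.diagonal dV))) :
            GL (Fin 2) (AdeleRing (𝓞 L) L)) =
          (toAdeleGL L g)⁻¹ * adelicVal (↥(maximalRealSubfield L)) L (IsCMField.complexConj L) 2 H k * toAdeleGL L g) →
    ∀ [CompactSpace (↥(UnitaryGroup.adelic (↥(maximalRealSubfield L)) L (IsCMField.complexConj L) 2 (Matrix.diagonal dV)) ⧸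
        (UnitaryGroup.toAdelic (↥(maximalRealSubfield L)) L (IsCMField.complexConj L) 2 (Matrix.diagonal dV)).range)]
      [CompactSpace (adelicGroupData (↥(maximalRealSubfield L)) L (IsCMField.complexConj L) 2 H).automorphicQuotient],
    ∀ P : DiscreteAutomorphicRep (adelicGroupData (↥(maximalRealSubfield L)) L (IsCMField.complexConj L) 2 H) μ,
      P.HasFinComponent σ →
      ∀ (𝒦 : Literature.NumberTheory.K2Lit.SiegelDoubled.IwasawaDatum L e₁ dV hdV (fun _ : Fin 1 => (1 : L)) (fun _ => map_one _)) (f : ℂ → ↥(HA L e₁ dV hdV (fun _ : Fin 1 => (1 : L)) (fun _ => map_one _)) → ℂ), Literature.NumberTheory.K2Lit.SiegelDoubled.IsStandardSectionFamily 𝒦 (toHeckeCharacter L lam⁻¹) f → (∀ s, Continuous (f s)) →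
      ∀ (w : (adelicGroupData (↥(maximalRealSubfield L)) L (IsCMField.complexConj L) 2 H).L2 μ), w ∈ P.space.toSubmodule → ∀ (w' : (adelicGroupData (↥(maximalRealSubfield L)) L (IsCMField.complexConj L) 2 H).L2 μ), w' ∈ P.space.toSubmodule →
      ∀ (U : Set ℂ) (s₁ : ℝ), IsOpen U → Convex ℝ U → (1 / 2 : ℂ) ∈ U → (1 : ℝ) ≤ s₁ → {s : ℂ | s₁ < s.re} ⊆ U →
      ∀ (Zc : ℂ → ℂ) (k : ℕ) (ρ : ℂ), 1 ≤ k → ρ ≠ 0 → DifferentiableOn ℂ Zc (U \ {(1 / 2 : ℂ)}) →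
        (∀ s : ℂ, s₁ < s.re → Zc s =
          Literature.NumberTheory.K2Lit.SiegelDoubled.doublingPairing (adelicGroupData (↥(maximalRealSubfield L)) L (IsCMField.complexConj L) 2 H) μ
            (Literature.NumberTheory.K2Lit.SiegelDoubled.toQuotFun₂ (adelicGroupData (↥(maximalRealSubfield L)) L (IsCMField.complexConj L) 2 H)
              (fun g => Literature.NumberTheory.K2Lit.SiegelDoubled.eisensteinSeriesDelta L e₁ dV hdV (fun _ : Fin 1 => (1 : L)) (fun _ => map_one _) (f s)
                (Literature.NumberTheory.K2Lit.SiegelDoubled.iotaV L e₁ dV hdV (fun _ : Fin 1 => (1 : L)) (fun _ => map_one _) (ιA g.1, ιA g.2))))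
            (fun α => w α)
            (fun α => Literature.NumberTheory.K2Lit.SiegelDoubled.siegelDeltaCharacter L e₁ dV hdV (fun _ : Fin 1 => (1 : L)) (fun _ => map_one _) (toHeckeCharacter L lam⁻¹) s
              (Literature.NumberTheory.K2Lit.SiegelDoubled.iotaV L e₁ dV hdV (fun _ : Fin 1 => (1 : L)) (fun _ => map_one _)
                (ιA ((Quotient.out (α : (adelicGroupData (↥(maximalRealSubfield L)) L (IsCMField.complexConj L) 2 H).Adelic ⧸ (adelicGroupData (↥(maximalRealSubfield L)) L (IsCMField.complexConj L) 2 H).quotientSubgroup)) : (adelicGroupData (↥(maximalRealSubfield L)) L (IsCMField.complexConj L) 2 H).Adelic)⁻¹,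
                 ιA ((Quotient.out (α : (adelicGroupData (↥(maximalRealSubfield L)) L (IsCMField.complexConj L) 2 H).Adelic ⧸ (adelicGroupData (↥(maximalRealSubfield L)) L (IsCMField.complexConj L) 2 H).quotientSubgroup)) : (adelicGroupData (↥(maximalRealSubfield L)) L (IsCMField.complexConj L) 2 H).Adelic)⁻¹)) * w' α)) →
        Filter.Tendsto (fun s : ℂ => (s - 1 / 2) ^ k * Zc s) (𝓝[≠] (1 / 2)) (𝓝 ρ) →
      ∃ (a' : (↥(maximalRealSubfield L))ˣ) (Φ₁ Φ₂ : piSchwartzBruhat (↥(maximalRealSubfield L)) (Fin n')),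
        letI : MeasurableSpace (↥(UnitaryGroup.adelic (↥(maximalRealSubfield L)) L (IsCMField.complexConj L) 1 (JW (↥(maximalRealSubfield L)) L a')) ⧸ (UnitaryGroup.toAdelic (↥(maximalRealSubfield L)) L (IsCMField.complexConj L) 1 (JW (↥(maximalRealSubfield L)) L a')).range) := borel _
        ∃ (ν : Measure (↥(UnitaryGroup.adelic (↥(maximalRealSubfield L)) L (IsCMField.complexConj L) 1 (JW (↥(maximalRealSubfield L)) L a')) ⧸ (UnitaryGroup.toAdelic (↥(maximalRealSubfield L)) L (IsCMField.complexConj L) 1 (JW (↥(maximalRealSubfield L)) L a')).range))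
          (_ : IsFiniteMeasure ν) (_ : SMulInvariantMeasure ↥(UnitaryGroup.adelic (↥(maximalRealSubfield L)) L (IsCMField.complexConj L) 1 (JW (↥(maximalRealSubfield L)) L a')) (↥(UnitaryGroup.adelic (↥(maximalRealSubfield L)) L (IsCMField.complexConj L) 1 (JW (↥(maximalRealSubfield L)) L a')) ⧸ (UnitaryGroup.toAdelic (↥(maximalRealSubfield L)) L (IsCMField.complexConj L) 1 (JW (↥(maximalRealSubfield L)) L a')).range) ν) (_ : ν.IsOpenPosMeasure) (f' : C((↥(UnitaryGroup.adelic (↥(maximalRealSubfield L)) L (IsCMField.complexConj L) 1 (JW (↥(maximalRealSubfield L)) L a')) ⧸ (UnitaryGroup.toAdelic (↥(maximalRealSubfield L)) L (IsCMField.complexConj L) 1 (JW (↥(maximalRealSubfield L)) L a')).range), ℂ))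
          (W₂ : (adelicGroupData (↥(maximalRealSubfield L)) L (IsCMField.complexConj L) 2 H).automorphicQuotient → ℂ), Integrable W₂ μ ∧
          Literature.NumberTheory.K2Lit.SiegelDoubled.doublingPairing (adelicGroupData (↥(maximalRealSubfield L)) L (IsCMField.complexConj L) 2 H) μ
            (fun x => ∫ q, f' q * (conj (toQuotFun (adelicGroupData (↥(maximalRealSubfield L)) L (IsCMField.complexConj L) 2 H)
                (fun y => (lineThetaKernelDatum L 2 e₁ dV hdV hdV0 lam hlam a'
              (hasThetaMajorants_lineThetaKernelDatum₂ L ι e₁ dV hdV hdV0 hpos lam hlam a')).thetaKer Φ₁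
                (QuotientGroup.mk (ιA y)⁻¹, q)) x.1) *
              toQuotFun (adelicGroupData (↥(maximalRealSubfield L)) L (IsCMField.complexConj L) 2 H)
                (fun y => (lineThetaKernelDatum L 2 e₁ dV hdV hdV0 lam hlam a'
              (hasThetaMajorants_lineThetaKernelDatum₂ L ι e₁ dV hdV hdV0 hpos lam hlam a')).thetaKer Φ₂
                (QuotientGroup.mk (ιA y)⁻¹, q)) x.2) ∂ν)
            (fun α => w α) W₂ ≠ 0 := by
  intro h41 h42 L _ _ _ ι H dV hdV hdV0 t ht g hg _hT hpos _hdeg μ _ n' e₁ lam hlam hwt a χ W _ _ σ _hirr _hsm j _hj ιA hιA _ _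
    Prep _hPrep 𝒦 f hstd hcont w _hw w' _hw' U s₁ hUo hUc hU hs₁ hUs Zc k ρ hk hρ hZd hZc hlimZ
  -- (D0) the letter enumeration forces `n′ = 2`
  obtain rfl : n' = 2 := by simpa using (Fintype.card_congr e₁).symm
  haveI hμfin : IsFiniteMeasure μ := inferInstance
  haveI : SecondCountableTopology (adelicGroupData (↥(maximalRealSubfield L)) L (IsCMField.complexConj L) 2 H).Adelic :=
    secondCountableTopology_cmDatum_Adelic L 2 H
  haveI : SecondCountableTopology (adelicGroupData (↥(maximalRealSubfield L)) L (IsCMField.complexConj L) 2 H).automorphicQuotient :=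
    inferInstanceAs (SecondCountableTopology ((adelicGroupData (↥(maximalRealSubfield L)) L (IsCMField.complexConj L) 2 H).Adelic ⧸
      (adelicGroupData (↥(maximalRealSubfield L)) L (IsCMField.complexConj L) 2 H).quotientSubgroup))
  -- the frame transport: continuity and rationality from the pin (★ `F0LD2FrameTransportPin`)
  have hιAc : Continuous ιA := continuous_of_pin L 2 H dV g ιA hιA
  have hιAr : ∀ ⦃γ : (adelicGroupData (↥(maximalRealSubfield L)) L (IsCMField.complexConj L) 2 H).Adelic⦄,
      γ ∈ (UnitaryGroup.toAdelic (↥(maximalRealSubfield L)) L (IsCMField.complexConj L) 2 H).range →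
        ιA γ ∈ (UnitaryGroup.toAdelic (↥(maximalRealSubfield L)) L (IsCMField.complexConj L) 2 (Matrix.diagonal dV)).range :=
    fun _ hγ => mem_range_toAdelic_of_pin L 2 H dV t ht g hg ιA hιA hγ
  -- (D41) socket #41 at the curve frame, `dW ≡ 1`, `χ_D = λ̃⁻¹`
  obtain ⟨P, Es, h_i, h_ii, h_iii, h_iv, h_v⟩ := h41 L e₁ dV hdV hdV0 (fun _ : Fin 1 => (1 : L)) (fun _ => map_one _)
    (fun _ => one_ne_zero) (toHeckeCharacter L lam⁻¹) (isUnitary_toHeckeCharacter L lam⁻¹) 𝒦 f hstd hcont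
  -- (D42) socket #42R at the same frame, doubled enumeration `e₂ := Equiv.prodUnique`
  obtain ⟨kk, a', κ, Φ', hρ', μW, fW, hfin, hinv, hlim⟩ := h42 L e₁ dV hdV hdV0 (fun _ : Fin 1 => (1 : L)) (fun _ => map_one _)
    (fun _ => one_ne_zero) lam hlam hwt 𝒦 f hstd hcont P Es h_i h_iv (Equiv.prodUnique (Fin (2 + 2)) (Fin 1))
  -- the slot weights: `w ∈ L²`, the doubling twist at `s = ½` is continuous (★ `continuous_twist`) hence `T · w′ ∈ L²`
  have hw2 : MemLp (fun α => w α) 2 μ := Lp.memLp w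
  have hTc : Continuous fun x : (adelicGroupData (↥(maximalRealSubfield L)) L (IsCMField.complexConj L) 2 H).automorphicQuotient =>
      siegelDeltaCharacter L e₁ dV hdV (fun _ : Fin 1 => (1 : L)) (fun _ => map_one _) (toHeckeCharacter L lam⁻¹) (1 / 2)
        (iotaV L e₁ dV hdV (fun _ : Fin 1 => (1 : L)) (fun _ => map_one _)
          (ιA ((Quotient.out (x : (adelicGroupData (↥(maximalRealSubfield L)) L (IsCMField.complexConj L) 2 H).Adelic ⧸ (adelicGroupData (↥(maximalRealSubfield L)) L (IsCMField.complexConj L) 2 H).quotientSubgroup)) : (adelicGroupData (↥(maximalRealSubfield L)) L (IsCMField.complexConj L) 2 H).Adelic)⁻¹,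
           ιA ((Quotient.out (x : (adelicGroupData (↥(maximalRealSubfield L)) L (IsCMField.complexConj L) 2 H).Adelic ⧸ (adelicGroupData (↥(maximalRealSubfield L)) L (IsCMField.complexConj L) 2 H).quotientSubgroup)) : (adelicGroupData (↥(maximalRealSubfield L)) L (IsCMField.complexConj L) 2 H).Adelic)⁻¹)) := by
    have h := Complex.continuous_conj.comp (continuous_twist L e₁ H dV hdV hdV0 (fun _ : Fin 1 => (1 : L)) (fun _ => map_one _)
      (fun _ => one_ne_zero) t ht g hg ιA hιA (toHeckeCharacter L lam⁻¹) (1 / 2))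
    simpa only [Function.comp_def, Complex.conj_conj] using h
  have hTw' : MemLp (fun α => siegelDeltaCharacter L e₁ dV hdV (fun _ : Fin 1 => (1 : L)) (fun _ => map_one _) (toHeckeCharacter L lam⁻¹) (1 / 2)
        (iotaV L e₁ dV hdV (fun _ : Fin 1 => (1 : L)) (fun _ => map_one _)
          (ιA ((Quotient.out (α : (adelicGroupData (↥(maximalRealSubfield L)) L (IsCMField.complexConj L) 2 H).Adelic ⧸ (adelicGroupData (↥(maximalRealSubfield L)) L (IsCMField.complexConj L) 2 H).quotientSubgroup)) : (adelicGroupData (↥(maximalRealSubfield L)) L (IsCMField.complexConj L) 2 H).Adelic)⁻¹,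
           ιA ((Quotient.out (α : (adelicGroupData (↥(maximalRealSubfield L)) L (IsCMField.complexConj L) 2 H).Adelic ⧸ (adelicGroupData (↥(maximalRealSubfield L)) L (IsCMField.complexConj L) 2 H).quotientSubgroup)) : (adelicGroupData (↥(maximalRealSubfield L)) L (IsCMField.complexConj L) 2 H).Adelic)⁻¹)) * w' α) 2 μ := by
    obtain ⟨C, hC⟩ := (isCompact_univ.image hTc).isBounded.exists_norm_le
    have htop : MemLp _ ∞ μ := memLp_top_of_bound (μ := μ) hTc.aestronglyMeasurable C
      (Eventually.of_forall fun x => hC _ (Set.mem_image_of_mem _ (Set.mem_univ x)))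
    exact MemLp.mul' (Lp.memLp w') htop
  have hw1 : Integrable (fun α => w α) μ := hw2.integrable one_le_two
  have hTw1 : Integrable (fun α => siegelDeltaCharacter L e₁ dV hdV (fun _ : Fin 1 => (1 : L)) (fun _ => map_one _) (toHeckeCharacter L lam⁻¹) (1 / 2)
        (iotaV L e₁ dV hdV (fun _ : Fin 1 => (1 : L)) (fun _ => map_one _)
          (ιA ((Quotient.out (α : (adelicGroupData (↥(maximalRealSubfield L)) L (IsCMField.complexConj L) 2 H).Adelic ⧸ (adelicGroupData (↥(maximalRealSubfield L)) L (IsCMField.complexConj L) 2 H).quotientSubgroup)) : (adelicGroupData (↥(maximalRealSubfield L)) L (IsCMField.complexConj L) 2 H).Adelic)⁻¹,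
           ιA ((Quotient.out (α : (adelicGroupData (↥(maximalRealSubfield L)) L (IsCMField.complexConj L) 2 H).Adelic ⧸ (adelicGroupData (↥(maximalRealSubfield L)) L (IsCMField.complexConj L) 2 H).quotientSubgroup)) : (adelicGroupData (↥(maximalRealSubfield L)) L (IsCMField.complexConj L) 2 H).Adelic)⁻¹)) * w' α) μ :=
    MemLp.integrable (μ := μ) one_le_two hTw'
  -- the regularised Eisenstein kernel `F s := toQuotFun₂ (E⋆(s) ∘ ι ∘ (ιA × ιA))`: measurable, holomorphic, locally uniformly bounded (★ `K2LiuEisensteinPairingKernel`)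
  have hFm : ∀ s : ℂ, 0 < s.re → AEStronglyMeasurable (toQuotFun₂ (adelicGroupData (↥(maximalRealSubfield L)) L (IsCMField.complexConj L) 2 H)
      (fun g => Es s (iotaV L e₁ dV hdV (fun _ : Fin 1 => (1 : L)) (fun _ => map_one _) (ιA g.1, ιA g.2)))) (μ.prod μ) := fun s hs =>
    (continuous_toQuotFun₂_eisenstein L e₁ H dV hdV (fun _ : Fin 1 => (1 : L)) (fun _ => map_one _) ιA hιAr hιAc (Es s) (h_ii s hs)
      (h_iii s hs)).aestronglyMeasurable
  have hFd : ∀ x, DifferentiableOn ℂ (fun s => toQuotFun₂ (adelicGroupData (↥(maximalRealSubfield L)) L (IsCMField.complexConj L) 2 H)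
      (fun g => Es s (iotaV L e₁ dV hdV (fun _ : Fin 1 => (1 : L)) (fun _ => map_one _) (ιA g.1, ιA g.2))) x) {s : ℂ | 0 < s.re} := fun x =>
    h_i _
  have hFb : ∀ z : ℂ, 0 < z.re → ∃ C r : ℝ, 0 < r ∧ ∀ s : ℂ, dist s z < r → 0 < s.re → ∀ x,
      ‖toQuotFun₂ (adelicGroupData (↥(maximalRealSubfield L)) L (IsCMField.complexConj L) 2 H)
        (fun g => Es s (iotaV L e₁ dV hdV (fun _ : Fin 1 => (1 : L)) (fun _ => map_one _) (ιA g.1, ιA g.2))) x‖ ≤ C := by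
    intro z hz
    obtain ⟨C, A, r, hr, hb⟩ := h_v z hz
    obtain ⟨M, -, hM⟩ := exists_bound_toQuotFun₂_eisenstein L e₁ H dV hdV (fun _ : Fin 1 => (1 : L)) (fun _ => map_one _) ιA hιAr hιAc A
    exact ⟨C * M, r, hr, fun s hs hs' x => hM (Es s) (h_iii s hs') C (hb s hs) x⟩
  have hlim' : ∀ x, Tendsto (fun s : ℂ => (s - 1 / 2) * (toQuotFun₂ (adelicGroupData (↥(maximalRealSubfield L)) L (IsCMField.complexConj L) 2 H)
      (fun g => Es s (iotaV L e₁ dV hdV (fun _ : Fin 1 => (1 : L)) (fun _ => map_one _) (ιA g.1, ιA g.2))) x / ∏ p ∈ P, (s - p))) (𝓝[≠] (1 / 2))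
      (𝓝 (toQuotFun₂ (adelicGroupData (↥(maximalRealSubfield L)) L (IsCMField.complexConj L) 2 H)
        (fun g => ∑ i, κ i * @doubledLineThetaLift L _ _ _ 2 1 2 e₁ dV hdV (fun _ : Fin 1 => (1 : L)) (fun _ => map_one _) (2 + 2)
          (Equiv.prodUnique (Fin (2 + 2)) (Fin 1)) hdV0 (fun _ => one_ne_zero) lam⁻¹ (K2LiuConjugateSymplecticInv.IsConjugateSymplectic.inv hlam)
          (a' i) (hρ' i) (borel _) (μW i) (Φ' i) (fW i) (iotaV L e₁ dV hdV (fun _ : Fin 1 => (1 : L)) (fun _ => map_one _) (ιA g.1, ιA g.2))) x)) :=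
    fun x => hlim _
  -- agreement with s5's continuation on `Re s > s₁ ≥ 1 = n/2` (#41 (iv), twist at `s` = twist at `½`)
  have hZc' : ∀ s : ℂ, s₁ < s.re → (∏ p ∈ P, (s - p)) * Zc s =
      doublingPairing (adelicGroupData (↥(maximalRealSubfield L)) L (IsCMField.complexConj L) 2 H) μ
        (toQuotFun₂ (adelicGroupData (↥(maximalRealSubfield L)) L (IsCMField.complexConj L) 2 H)
          (fun g => Es s (iotaV L e₁ dV hdV (fun _ : Fin 1 => (1 : L)) (fun _ => map_one _) (ιA g.1, ιA g.2)))) (fun α => w α)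
        (fun α => siegelDeltaCharacter L e₁ dV hdV (fun _ : Fin 1 => (1 : L)) (fun _ => map_one _) (toHeckeCharacter L lam⁻¹) (1 / 2)
          (iotaV L e₁ dV hdV (fun _ : Fin 1 => (1 : L)) (fun _ => map_one _)
            (ιA ((Quotient.out (α : (adelicGroupData (↥(maximalRealSubfield L)) L (IsCMField.complexConj L) 2 H).Adelic ⧸ (adelicGroupData (↥(maximalRealSubfield L)) L (IsCMField.complexConj L) 2 H).quotientSubgroup)) : (adelicGroupData (↥(maximalRealSubfield L)) L (IsCMField.complexConj L) 2 H).Adelic)⁻¹,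
             ιA ((Quotient.out (α : (adelicGroupData (↥(maximalRealSubfield L)) L (IsCMField.complexConj L) 2 H).Adelic ⧸ (adelicGroupData (↥(maximalRealSubfield L)) L (IsCMField.complexConj L) 2 H).quotientSubgroup)) : (adelicGroupData (↥(maximalRealSubfield L)) L (IsCMField.complexConj L) 2 H).Adelic)⁻¹)) * w' α) := by
    intro s hs
    have hs2 : ((2 : ℕ) : ℝ) / 2 < s.re := by
      have h1 : ((2 : ℕ) : ℝ) / 2 = 1 := by norm_num
      rw [h1]
      linarith
    -- the doubling twist does not depend on `s` (★ `twist_eq_twist`)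
    have e1 : Zc s = doublingPairing (adelicGroupData (↥(maximalRealSubfield L)) L (IsCMField.complexConj L) 2 H) μ
        (toQuotFun₂ (adelicGroupData (↥(maximalRealSubfield L)) L (IsCMField.complexConj L) 2 H)
          (fun g => eisensteinSeriesDelta L e₁ dV hdV (fun _ : Fin 1 => (1 : L)) (fun _ => map_one _) (f s)
            (iotaV L e₁ dV hdV (fun _ : Fin 1 => (1 : L)) (fun _ => map_one _) (ιA g.1, ιA g.2)))) (fun α => w α)
        (fun α => siegelDeltaCharacter L e₁ dV hdV (fun _ : Fin 1 => (1 : L)) (fun _ => map_one _) (toHeckeCharacter L lam⁻¹) (1 / 2)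
          (iotaV L e₁ dV hdV (fun _ : Fin 1 => (1 : L)) (fun _ => map_one _)
            (ιA ((Quotient.out (α : (adelicGroupData (↥(maximalRealSubfield L)) L (IsCMField.complexConj L) 2 H).Adelic ⧸ (adelicGroupData (↥(maximalRealSubfield L)) L (IsCMField.complexConj L) 2 H).quotientSubgroup)) : (adelicGroupData (↥(maximalRealSubfield L)) L (IsCMField.complexConj L) 2 H).Adelic)⁻¹,
             ιA ((Quotient.out (α : (adelicGroupData (↥(maximalRealSubfield L)) L (IsCMField.complexConj L) 2 H).Adelic ⧸ (adelicGroupData (↥(maximalRealSubfield L)) L (IsCMField.complexConj L) 2 H).quotientSubgroup)) : (adelicGroupData (↥(maximalRealSubfield L)) L (IsCMField.complexConj L) 2 H).Adelic)⁻¹)) * w' α) := by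
      rw [hZc s hs]
      congr 1
      funext α
      rw [twist_eq_twist L e₁ dV hdV hdV0 (fun _ : Fin 1 => (1 : L)) (fun _ => map_one _) (fun _ => one_ne_zero) (toHeckeCharacter L lam⁻¹) s (1 / 2)]
    rw [e1, ← doublingPairing_const_mul]
    congr 1
    funext x
    simp only [toQuotFun₂]
    rw [h_iv s _ hs2]
    rfl
  -- (D43a)–(D46) THE RESIDUE CHAIN (★ `K2LiuFirstTermResidueChain`): the residue kernel pairs non-trivially
  have hR := doublingPairing_residue_ne_zero (adelicGroupData (↥(maximalRealSubfield L)) L (IsCMField.complexConj L) 2 H) μ hw2 hTw' P _ _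
    hFm hFd hFb hlim' U s₁ hUo hUc hU (zero_le_one.trans hs₁) hUs Zc k ρ hk hρ hZd hZc' hlimZ
  -- (D45∕44) one line of the finite sum pairs non-trivially (kernels continuous by ★ `continuous_toQuotFun₂_doubledLineThetaLift`)
  rw [toQuotFun₂_finset_sum] at hR
  have hfs := exists_doublingPairing_ne_zero_of_finset_sum (adelicGroupData (↥(maximalRealSubfield L)) L (IsCMField.complexConj L) 2 H) μ
    Finset.univ κ _ (fun i _ => by
      letI : MeasurableSpace (↥(UnitaryGroup.adelic (↥(maximalRealSubfield L)) L (IsCMField.complexConj L) 1 (JW (↥(maximalRealSubfield L)) L (a' i))) ⧸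
          (UnitaryGroup.toAdelic (↥(maximalRealSubfield L)) L (IsCMField.complexConj L) 1 (JW (↥(maximalRealSubfield L)) L (a' i))).range) := borel _
      haveI : BorelSpace (↥(UnitaryGroup.adelic (↥(maximalRealSubfield L)) L (IsCMField.complexConj L) 1 (JW (↥(maximalRealSubfield L)) L (a' i))) ⧸
          (UnitaryGroup.toAdelic (↥(maximalRealSubfield L)) L (IsCMField.complexConj L) 1 (JW (↥(maximalRealSubfield L)) L (a' i))).range) := ⟨rfl⟩
      haveI := hfin i
      -- elaborate the organ WITHOUT expected type (expected-type propagation through its dependent telescope times out)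
      have hc := continuous_toQuotFun₂_doubledLineThetaLift L e₁ H dV hdV (fun _ : Fin 1 => (1 : L)) (fun _ => map_one _)
        (Equiv.prodUnique (Fin (2 + 2)) (Fin 1)) hdV0 (fun _ => one_ne_zero) lam⁻¹ (K2LiuConjugateSymplecticInv.IsConjugateSymplectic.inv hlam)
        (a' i) (hρ' i) ιA hιAc hιAr (μW i) (fW i) (Φ' i)
      exact hc) hw1 hTw1 hR
  -- (`rcases` on `∃ i ∈ Finset.univ, …` is avoided: its `whnf` of the membership hypothesis times out in this context)
  refine hfs.elim fun i hi => ?_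
  replace hi := hi.2
  -- (O45ii) ★ #45D: move the datum into the pure-tensor span
  obtain ⟨a₂, hρ₂, μ₂, hfin₂, hinv₂, Φ₂', hspan₂, f₂, hne₂⟩ :=
    K2LiuDoublingPairingTensorSeparation.doublingPairingTensorSeparation L H dV hdV hdV0 e₁ (Equiv.prodUnique (Fin (2 + 2)) (Fin 1)) lam hlam μ ιA
      hιAc hιAr _ _ hw1 hTw1 ⟨a' i, hρ' i, μW i, hfin i, hinv i, Φ' i, fW i, hi⟩
  -- (c1) the sign data of the curve frame: signature «all but one» at `ι`, definite at the other complex places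
  have h₁V : ∃ i₀ : Fin 2, (∀ i, i ≠ i₀ → 0 < (ι (dV i)).re) ∨ ∀ i, i ≠ i₀ → (ι (dV i)).re < 0 := by
    refine ⟨0, ?_⟩
    have hne := re_apply_ne_zero_of_complexConj_eq L ι (hdV 1) (hdV0 1)
    rcases lt_or_gt_of_ne hne with hneg | hpos'
    · exact Or.inr fun i hi => by
        rw [Fin.eq_one_of_ne_zero i hi]
        exact hneg
    · exact Or.inl fun i hi => by
        rw [Fin.eq_one_of_ne_zero i hi]
        exact hpos'
  have hV : ∀ τ : L →+* ℂ, InfinitePlace.mk τ ≠ InfinitePlace.mk ι → (∀ i, 0 < (τ (dV i)).re) ∨ ∀ i, (τ (dV i)).re < 0 := fun τ hτ =>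
    Or.inl fun i => by
      have h2 := hpos τ hτ
      rw [Matrix.diagonal_map (map_zero _)] at h2
      exact (Complex.pos_iff.1 ((Matrix.posDef_diagonal_iff.1 h2) i)).1
  -- ★ #44∕45R: undouble and separate; the majorant witness is proof-irrelevant against ★ `hasThetaMajorants_lineThetaKernelDatum₂`
  obtain ⟨a₃, hρ₃, ν, hν₁, hν₂, hν₃, Ψ₁, Ψ₂, f', W₂, hW₂, hne₃⟩ :=
    K2LiuUndoublingSeparation.undoublingSeparation L H dV hdV hdV0 ι h₁V hV e₁ (Equiv.prodUnique (Fin (2 + 2)) (Fin 1)) lam hlam μ ιA hιAc hιAr _ _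
      hw1 hTw1 ⟨a₂, hρ₂, μ₂, hfin₂, hinv₂, Φ₂', hspan₂, f₂, hne₂⟩
  exact ⟨a₃, Ψ₁, Ψ₂, ν, hν₁, hν₂, hν₃, f', W₂, hW₂, hne₃⟩

end Summit.HodgeConjecture.HodgeConjecture.Cruxes.HLiu418.K2LiuFirstTermThetaPairing

end
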